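import Literature.Analysis.FluidPDE.KNSSRegularity
import Literature.Analysis.FluidPDE.LiebermanBarrier
import Literature.Analysis.FluidPDE.ParabolicComparison
import HarnessLib

/-!
# Spreading of positivity for the time-integrated drift–diffusion class (Lieberman, Lemma 2.6)

Analysis/FluidPDE proofs file (theorems only), second layer of the proof of the named fact
`Literature.Analysis.FluidPDE.KNSS2009_lemma21_halfball` (KNSS 2009, Lemma 2.1 in half-ball
form; the discharge itself is `KNSSLemma21`). For the class of that fact — `f : ℝ → E → ℝ` with
`C²` slices, bounded and jointly continuous `Df`, `Δf` on `(−∞, 0) × E`, and the equation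
`f(t) − f(s) = ∫ₛᵗ (Δf − Df[a]) dτ` with a bounded measurable drift `a` — it proves:

* `intervalIntegrable_lemma21_rhs`, `abs_sub_le_of_lemma21`, `continuousOn_uncurry_of_lemma21`:
  the right-hand side is integrable on compact time intervals, `f` is Lipschitz in `t` and
  jointly continuous (so the comparison principle of `ParabolicComparison` applies to
  `g = M₁ − f`);
* `spread_of_positivity` — **Lieberman 1996, Ch. II, Lemma 2.6** for `g = M₁ − f ≥ 0`
  (`M₁ ≥ f`): if `g(t_b, ·) ≥ h > 0` on `B̄(y_c, εL)` then `g(t_T, ·) ≥ (h/2) ε^{2q}/ε⁴` on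
  `B̄(y_c, L/2)`, for the expanding paraboloid from `(t_b, εL)` to `(t_T, L)` and Lieberman's
  exponent `q` (`32 m q ≥ F²`, `F = 8 + 4n + 4AL + 2m`, `m = (1 − ε²)L²/(t_T − t_b)`): the barrier
  of `LiebermanBarrier` is a subsolution for every drift `|a| ≤ A` at once, lies below `g` on the
  parabolic boundary, hence below `g` inside by `paraboloid_comparison`. Only **boundedness** of
  the drift is used — no continuity and no compactness argument.

## References

* G. M. Lieberman, *Second Order Parabolic Differential Equations*, World Scientific (1996),
  Ch. II, Lemma 2.6 (pp. 10–11). [Lieberman1996]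
* G. Koch, N. Nadirashvili, G. Seregin, V. Šverák, *Liouville theorems for the Navier–Stokes
  equations and applications*, Acta Math. 203 (2009) = arXiv:0709.3599, Lemma 2.1 (p. 5).
  [KochNadirashviliSereginSverak2009]
-/
noncomputable section

open MeasureTheory Set Function Filter TopologicalSpace InnerProductSpace Metric
open scoped RealInnerProductSpace Laplacian ContDiff Topology NNReal

namespace Literature.Analysis.FluidPDE

variable {E : Type*} [NormedAddCommGroup E] [InnerProductSpace ℝ E] [FiniteDimensional ℝ E]
  [MeasurableSpace E] [BorelSpace E]

/-! ### The time-integrated class: integrability and joint continuity -/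

section Class
omit [InnerProductSpace ℝ E] [FiniteDimensional ℝ E] [MeasurableSpace E] [BorelSpace E] in
/-- A time slice `τ ↦ F(τ, y)` of a function continuous on the slab `(−∞, 0) × E` is continuous on
every set of negative times (composition with `τ ↦ (τ, y)`, arguments given explicitly to keep
unification first order). [folklore] -/
theorem continuousOn_slab_slice {X : Type*} [TopologicalSpace X] {F : ℝ × E → X}
    (hF : ContinuousOn F (Iio 0 ×ˢ univ)) (y : E) {S : Set ℝ} (hS : S ⊆ Iio 0) :
    ContinuousOn (fun τ => F (τ, y)) S := by
  have hmaps : MapsTo (fun τ : ℝ => (τ, y)) S (Iio 0 ×ˢ (univ : Set E)) :=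
    fun τ hτ => ⟨hS hτ, mem_univ _⟩
  have hl : Continuous fun τ : ℝ => (τ, y) := continuous_id.prodMk continuous_const
  exact ContinuousOn.comp (g := F) (f := fun τ : ℝ => (τ, y)) hF hl.continuousOn hmaps

variable {f : ℝ → E → ℝ} {a : ℝ → E → E} {A C : ℝ}

/-- The right-hand side `τ ↦ Δf(τ, ·)(y) − Df(τ, ·)(y)[a(τ, y)]` of the integrated equation is
integrable on every compact time interval below `0`: it is bounded, the `Δf`-part is continuous
in `τ`, and the drift part is a continuous linear-map-valued function of `τ` evaluated at a
measurable vector. [folklore] -/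
theorem intervalIntegrable_lemma21_rhs (ha_m : Measurable (uncurry a))
    (haA : ∀ t < 0, ∀ y, ‖a t y‖ ≤ A)
    (hfD : ∀ t < 0, ∀ y, ‖fderiv ℝ (f t) y‖ ≤ C ∧ |(Δ (f t)) y| ≤ C)
    (hcD : ContinuousOn (fun p : ℝ × E => fderiv ℝ (f p.1) p.2) (Iio 0 ×ˢ univ))
    (hcΔ : ContinuousOn (fun p : ℝ × E => (Δ (f p.1)) p.2) (Iio 0 ×ˢ univ)) (y : E) {s t : ℝ}
    (hst : s ≤ t) (ht : t < 0) :
    IntervalIntegrable (fun τ => (Δ (f τ)) y - fderiv ℝ (f τ) y (a τ y)) volume s t := by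
  have hsub : Icc s t ⊆ Iio 0 := fun τ hτ => lt_of_le_of_lt hτ.2 ht
  have hΔc : ContinuousOn (fun τ => (Δ (f τ)) y) (Icc s t) := continuousOn_slab_slice hcΔ y hsub
  have hDc : ContinuousOn (fun τ => fderiv ℝ (f τ) y) (Icc s t) :=
    continuousOn_slab_slice hcD y hsub
  have hay : Measurable fun τ : ℝ => a τ y := ha_m.comp (measurable_id.prodMk measurable_const)
  -- measurability on `[s, t]`
  have hmeas : AEStronglyMeasurable (fun τ => (Δ (f τ)) y - fderiv ℝ (f τ) y (a τ y))
      (volume.restrict (Icc s t)) := by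
    refine (hΔc.aestronglyMeasurable measurableSet_Icc).sub ?_
    have h1 : AEStronglyMeasurable (fun τ => (fderiv ℝ (f τ) y, a τ y))
        (volume.restrict (Icc s t)) :=
      (hDc.aestronglyMeasurable measurableSet_Icc).prodMk hay.aestronglyMeasurable
    exact (isBoundedBilinearMap_apply (𝕜 := ℝ) (E := E) (F := ℝ)).continuous
      |>.comp_aestronglyMeasurable h1
  -- boundedness
  have hA0 : 0 ≤ A := (norm_nonneg _).trans (haA (-1) (by norm_num) y)
  have hbound : ∀ᵐ τ ∂(volume.restrict (Icc s t)),
      ‖(Δ (f τ)) y - fderiv ℝ (f τ) y (a τ y)‖ ≤ C + C * A := by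
    filter_upwards [ae_restrict_mem measurableSet_Icc] with τ hτ
    have hτ0 : τ < 0 := hsub hτ
    obtain ⟨hD, hL⟩ := hfD τ hτ0 y
    have h2 : ‖fderiv ℝ (f τ) y (a τ y)‖ ≤ C * A :=
      (ContinuousLinearMap.le_opNorm _ _).trans (mul_le_mul hD (haA τ hτ0 y) (norm_nonneg _)
        ((norm_nonneg _).trans hD))
    calc ‖(Δ (f τ)) y - fderiv ℝ (f τ) y (a τ y)‖
        ≤ ‖(Δ (f τ)) y‖ + ‖fderiv ℝ (f τ) y (a τ y)‖ := norm_sub_le _ _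
      _ ≤ C + C * A := add_le_add (by rw [Real.norm_eq_abs]; exact hL) h2
  have hint : IntegrableOn (fun τ => (Δ (f τ)) y - fderiv ℝ (f τ) y (a τ y)) (Icc s t) volume :=
    IntegrableOn.of_bound measure_Icc_lt_top hmeas _ hbound
  rw [intervalIntegrable_iff_integrableOn_Icc_of_le hst]
  exact hint

omit [MeasurableSpace E] [BorelSpace E] in
/-- **Time-Lipschitz bound** in the integrated class: `|f(t, y) − f(s, y)| ≤ (C + CA)|t − s|` for
`s, t < 0` (bound the integrand of `f(t) − f(s) = ∫ₛᵗ (Δf − Df[a])`). [folklore] -/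
theorem abs_sub_le_of_lemma21 (haA : ∀ t < 0, ∀ y, ‖a t y‖ ≤ A)
    (hfD : ∀ t < 0, ∀ y, ‖fderiv ℝ (f t) y‖ ≤ C ∧ |(Δ (f t)) y| ≤ C)
    (heq : ∀ y, ∀ s t : ℝ, s ≤ t → t < 0 →
      f t y - f s y = ∫ τ in s..t, ((Δ (f τ)) y - fderiv ℝ (f τ) y (a τ y)))
    (y : E) {s t : ℝ} (hs : s < 0) (ht : t < 0) :
    |f t y - f s y| ≤ (C + C * A) * |t - s| := by
  -- the bound on the integrand below `0`
  have hG : ∀ τ < 0, ‖(Δ (f τ)) y - fderiv ℝ (f τ) y (a τ y)‖ ≤ C + C * A := by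
    intro τ hτ0
    obtain ⟨hD, hL⟩ := hfD τ hτ0 y
    have h2 : ‖fderiv ℝ (f τ) y (a τ y)‖ ≤ C * A :=
      (ContinuousLinearMap.le_opNorm _ _).trans (mul_le_mul hD (haA τ hτ0 y) (norm_nonneg _)
        ((norm_nonneg _).trans hD))
    calc ‖(Δ (f τ)) y - fderiv ℝ (f τ) y (a τ y)‖
        ≤ ‖(Δ (f τ)) y‖ + ‖fderiv ℝ (f τ) y (a τ y)‖ := norm_sub_le _ _
      _ ≤ C + C * A := add_le_add (by rw [Real.norm_eq_abs]; exact hL) h2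
  rcases le_total s t with hst | hts
  · rw [heq y s t hst ht, ← Real.norm_eq_abs]
    refine intervalIntegral.norm_integral_le_of_norm_le_const fun τ hτ => hG τ ?_
    rw [uIoc_of_le hst] at hτ
    exact lt_of_le_of_lt hτ.2 ht
  · rw [abs_sub_comm, heq y t s hts hs, ← Real.norm_eq_abs, abs_sub_comm]
    refine intervalIntegral.norm_integral_le_of_norm_le_const fun τ hτ => hG τ ?_
    rw [uIoc_of_le hts] at hτ
    exact lt_of_le_of_lt hτ.2 hs

omit [MeasurableSpace E] [BorelSpace E] in
/-- **Joint continuity** of a member of the integrated class on `(−∞, 0) × E`: Lipschitz in `t`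
(uniformly in `y`) by `abs_sub_le_of_lemma21`, continuous in `y` for each `t`. [folklore] -/
theorem continuousOn_uncurry_of_lemma21 (haA : ∀ t < 0, ∀ y, ‖a t y‖ ≤ A)
    (hf2 : ∀ t < 0, ContDiff ℝ 2 (f t))
    (hfD : ∀ t < 0, ∀ y, ‖fderiv ℝ (f t) y‖ ≤ C ∧ |(Δ (f t)) y| ≤ C)
    (heq : ∀ y, ∀ s t : ℝ, s ≤ t → t < 0 →
      f t y - f s y = ∫ τ in s..t, ((Δ (f τ)) y - fderiv ℝ (f τ) y (a τ y))) :
    ContinuousOn (uncurry f) (Iio 0 ×ˢ univ) := by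
  refine continuousOn_prod_of_continuousOn_lipschitzOnWith _ (Real.toNNReal (C + C * A))
    (fun t ht => ((hf2 t ht).continuous).continuousOn) (fun y _ => ?_)
  refine LipschitzOnWith.of_dist_le' fun t ht s hs => ?_
  rw [Real.dist_eq, Real.dist_eq]
  exact abs_sub_le_of_lemma21 haA hfD heq y hs ht

end Class

/-! ### Spreading of positivity (Lieberman 1996, Lemma 2.6) for the integrated class -/

section Spread
variable {f : ℝ → E → ℝ} {a : ℝ → E → E} {A C M₁ : ℝ}

set_option maxHeartbeats 400000 in
/-- **Spreading of positivity** (Lieberman 1996, Ch. II, Lemma 2.6, for the supersolution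
`g = M₁ − f ≥ 0` of `gₜ = Δg − a·∇g` in the time-integrated class with `|a| ≤ A`). Fix a centre
`y_c`, times `t_b < t_T < 0`, a radius `L > 0`, `0 < ε ≤ 1/2`, and let
`P(t) = ε²L² + m(t − t_b)` with `m = (1 − ε²)L²/(t_T − t_b)` (so `P(t_b) = ε²L²`, `P(t_T) = L²`),
and a natural `q ≥ 2` with `32 m q ≥ F²`, `F = 8 + 4n + 4AL + 2m` (Lieberman's choice). If
`g(t_b, ·) ≥ h > 0` on `B̄(y_c, εL)`, then `g(t_T, ·) ≥ (h/2) ε^{2q}/ε⁴` on `B̄(y_c, L/2)`.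
Proof as printed: the barrier `v = c ψ`, `ψ = (P − |x − y_c|²)²/P^q`, `c = h (ε²L²)^q/(ε²L²)²`,
satisfies `vₜ ≤ Δv − A|Dv|` in the paraboloid `{|x − y_c|² < P(t)}` (`LiebermanBarrier`),
`v ≤ h ≤ g` on its bottom `B̄(y_c, εL) × {t_b}` and `v = 0 ≤ g` on its side, so `v ≤ g` inside by
`paraboloid_comparison`; at the top, `ψ ≥ (3L²/4)²/L^{2q}` on `B̄(y_c, L/2)`. [cite: Lieberman1996, Ch. II Lemma 2.6 (pp. 10–11)] -/
theorem spread_of_positivity (ha_m : Measurable (uncurry a)) (haA : ∀ t < 0, ∀ y, ‖a t y‖ ≤ A)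
    (hf2 : ∀ t < 0, ContDiff ℝ 2 (f t))
    (hfD : ∀ t < 0, ∀ y, ‖fderiv ℝ (f t) y‖ ≤ C ∧ |(Δ (f t)) y| ≤ C)
    (hcD : ContinuousOn (fun p : ℝ × E => fderiv ℝ (f p.1) p.2) (Iio 0 ×ˢ univ))
    (hcΔ : ContinuousOn (fun p : ℝ × E => (Δ (f p.1)) p.2) (Iio 0 ×ˢ univ))
    (heq : ∀ y, ∀ s t : ℝ, s ≤ t → t < 0 →
      f t y - f s y = ∫ τ in s..t, ((Δ (f τ)) y - fderiv ℝ (f τ) y (a τ y)))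
    (hle : ∀ t < 0, ∀ y, f t y ≤ M₁)
    {yc : E} {t_b t_T L ε h : ℝ} (htb : t_b < t_T) (htT : t_T < 0) (hL : 0 < L)
    (hε0 : 0 < ε) (hε1 : ε ≤ 1 / 2) (hh : 0 < h) {q : ℕ} (hq2 : 2 ≤ q)
    (hq : (8 + 4 * (Module.finrank ℝ E : ℝ) + 4 * A * L +
        2 * ((1 - ε ^ 2) * L ^ 2 / (t_T - t_b))) ^ 2 ≤
      32 * ((1 - ε ^ 2) * L ^ 2 / (t_T - t_b)) * q)
    (hbottom : ∀ x, ‖x - yc‖ ≤ ε * L → h ≤ M₁ - f t_b x) :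
    ∀ x, ‖x - yc‖ ≤ L / 2 → h / 2 * (ε ^ 2) ^ q / ε ^ 4 ≤ M₁ - f t_T x := by
  -- constants
  have hA0 : 0 ≤ A := (norm_nonneg _).trans (haA (-1) (by norm_num) yc)
  set n : ℝ := (Module.finrank ℝ E : ℝ) with hn
  set p₀ : ℝ := ε ^ 2 * L ^ 2 with hp₀
  have hp₀pos : 0 < p₀ := by positivity
  set m : ℝ := (1 - ε ^ 2) * L ^ 2 / (t_T - t_b) with hm
  have hε2 : ε ^ 2 ≤ 1 / 4 := by nlinarith
  have hmpos : 0 < m := by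
    have : 0 < 1 - ε ^ 2 := by linarith
    positivity
  set P : ℝ → ℝ := fun t => p₀ + m * (t - t_b) with hP
  have hPc : Continuous P := by rw [hP]; fun_prop
  have hPtb : P t_b = p₀ := by simp [hP]
  have hPtT : P t_T = L ^ 2 := by
    have hd : t_T - t_b ≠ 0 := by linarith
    simp only [hP, hp₀, hm]
    field_simp
    ring
  have hPge : ∀ t ∈ Icc t_b t_T, p₀ ≤ P t := fun t ht => by
    simp only [hP]; nlinarith [ht.1, hmpos.le]
  have hPle : ∀ t ∈ Icc t_b t_T, P t ≤ L ^ 2 := fun t ht => by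
    rw [← hPtT]; simp only [hP]; nlinarith [ht.2, hmpos.le]
  have hPpos : ∀ t ∈ Icc t_b t_T, 0 < P t := fun t ht => hp₀pos.trans_le (hPge t ht)
  have hq0 : q ≠ 0 := by omega
  set c : ℝ := h * p₀ ^ q / p₀ ^ 2 with hc
  have hcpos : 0 < c := by positivity
  have hIoc0 : Ioc t_b t_T ⊆ Iio 0 := fun τ hτ => lt_of_le_of_lt hτ.2 htT
  have hIcc0 : Icc t_b t_T ⊆ Iio 0 := fun τ hτ => lt_of_le_of_lt hτ.2 htT
  -- the barrier, its time derivative, and `g`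
  set v : ℝ → E → ℝ := fun t x => (P t - ‖x - yc‖ ^ 2) ^ 2 / (P t ^ q / c) with hv
  set vt : ℝ → E → ℝ := fun t x =>
    c * (m * (2 * (P t - ‖x - yc‖ ^ 2) - q * (P t - ‖x - yc‖ ^ 2) ^ 2 / P t) / P t ^ q) with hvt
  set g : ℝ → E → ℝ := fun t x => M₁ - f t x with hg
  have hg0 : ∀ t < 0, ∀ x, 0 ≤ g t x := fun t ht x => by simp only [hg]; linarith [hle t ht x]
  -- the comparison principle applies: first its sixteen hypotheses
  have H1 : ContinuousOn (uncurry v) (Icc t_b t_T ×ˢ univ) := by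
    have hnum : Continuous fun p : ℝ × E => (P p.1 - ‖p.2 - yc‖ ^ 2) ^ 2 := by fun_prop
    have hden : Continuous fun p : ℝ × E => P p.1 ^ q / c := by fun_prop
    refine (hnum.continuousOn.div hden.continuousOn fun p hp => ?_)
    exact div_ne_zero (pow_ne_zero _ (hPpos p.1 hp.1).ne') hcpos.ne'
  have H2 : ∀ t, ContDiff ℝ 2 (v t) := fun t => contDiff_paraboloidBarrier yc (P t) (P t ^ q / c)
  have H3 : ∀ x, ∀ t ∈ Icc t_b t_T, HasDerivAt (fun τ => v τ x) (vt t x) t := by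
    intro x t ht
    have hPt : p₀ + m * (t - t_b) ≠ 0 := (hPpos t ht).ne'
    have h1 := (hasDerivAt_paraboloidBarrier_time p₀ m t_b (‖x - yc‖ ^ 2) hq0 hPt).const_mul c
    have hfun : (fun τ => v τ x) = fun τ => c * ((p₀ + m * (τ - t_b) - ‖x - yc‖ ^ 2) ^ 2 /
        (p₀ + m * (τ - t_b)) ^ q) := by
      funext τ
      simp only [hv, hP]
      rw [div_div_eq_mul_div]
      ring
    rw [hfun]
    exact h1.congr_deriv (by simp only [hvt, hP])
  have hP1 : ContinuousOn (fun τ => P τ) (Icc t_b t_T) := hPc.continuousOn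
  have hP0' : ∀ τ ∈ Icc t_b t_T, P τ ≠ 0 := fun τ hτ => (hPpos τ hτ).ne'
  have hPq0 : ∀ τ ∈ Icc t_b t_T, P τ ^ q / c ≠ 0 := fun τ hτ =>
    div_ne_zero (pow_ne_zero _ (hP0' τ hτ)) hcpos.ne'
  have H4 : ∀ x, ContinuousOn (fun τ => vt τ x) (Icc t_b t_T) := by
    intro x
    simp only [hvt]
    refine continuousOn_const.mul ((continuousOn_const.mul ?_).div (hP1.pow q)
      fun τ hτ => pow_ne_zero _ (hP0' τ hτ))
    exact (continuousOn_const.mul (hP1.sub continuousOn_const)).sub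
      ((continuousOn_const.mul ((hP1.sub continuousOn_const).pow 2)).div hP1 hP0')
  have H5 : ∀ x, ContinuousOn (fun τ => fderiv ℝ (v τ) x) (Icc t_b t_T) := by
    intro x
    have hD : (fun τ => fderiv ℝ (v τ) x) =
        fun τ => (-(4 * (P τ - ‖x - yc‖ ^ 2) / (P τ ^ q / c))) • innerSL ℝ (x - yc) :=
      funext fun τ => (hasFDerivAt_paraboloidBarrier yc (P τ) (P τ ^ q / c) x).fderiv
    rw [hD]
    have hsc : ContinuousOn (fun τ => -(4 * (P τ - ‖x - yc‖ ^ 2) / (P τ ^ q / c))) (Icc t_b t_T) :=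
      ((continuousOn_const.mul (hP1.sub continuousOn_const)).div ((hP1.pow q).div_const c)
        hPq0).neg
    exact ContinuousOn.smul (f := fun τ => -(4 * (P τ - ‖x - yc‖ ^ 2) / (P τ ^ q / c)))
      (g := fun _ => innerSL ℝ (x - yc)) hsc continuousOn_const
  have H6 : ∀ x, ContinuousOn (fun τ => (Δ (v τ)) x) (Icc t_b t_T) := by
    intro x
    have hΔ : (fun τ => (Δ (v τ)) x) = fun τ =>
        (8 * ‖x - yc‖ ^ 2 - 4 * n * (P τ - ‖x - yc‖ ^ 2)) / (P τ ^ q / c) :=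
      funext fun τ => laplacian_paraboloidBarrier yc (P τ) (P τ ^ q / c) x
    rw [hΔ]
    exact (continuousOn_const.sub (continuousOn_const.mul (hP1.sub continuousOn_const))).div
      ((hP1.pow q).div_const c) hPq0
  have H7 : ∀ t ∈ Ioc t_b t_T, ∀ x, ‖x - yc‖ ^ 2 < P t →
      vt t x ≤ (Δ (v t)) x - A * ‖fderiv ℝ (v t) x‖ := by
    intro t ht x hx
    have htI : t ∈ Icc t_b t_T := Ioc_subset_Icc_self ht
    have hPt : 0 < P t := hPpos t htI
    have hPq : 0 < P t ^ q := pow_pos hPt q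
    set r : ℝ := ‖x - yc‖ ^ 2 with hr
    set S : ℝ := P t - r with hS
    have hS0 : 0 < S := by rw [hS]; linarith
    have hdL : ‖x - yc‖ ≤ L := le_of_sq_le_sq (hx.le.trans (hPle t htI)) hL.le
    have hΔv : (Δ (v t)) x = (8 * r - 4 * n * S) / (P t ^ q / c) :=
      laplacian_paraboloidBarrier yc (P t) (P t ^ q / c) x
    have hNv : ‖fderiv ℝ (v t) x‖ = |4 * S / (P t ^ q / c)| * ‖x - yc‖ :=
      norm_fderiv_paraboloidBarrier yc (P t) (P t ^ q / c) x
    have habs : |4 * S / (P t ^ q / c)| = 4 * S * c / P t ^ q := by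
      rw [abs_of_pos (by positivity), div_div_eq_mul_div]
    have key := paraboloidBarrier_ineq (n := n) (q := (q : ℝ)) hPt hS0.le hdL hA0 hq
    have hr' : r = P t - S := by rw [hS]; ring
    have e1 : vt t x = (c / P t ^ q) * (m * (2 * S - q * S ^ 2 / P t)) := by
      simp only [hvt, hS, hr]; ring
    have e2 : (Δ (v t)) x = (c / P t ^ q) * (8 * (P t - S) - 4 * n * S) := by
      rw [hΔv, hr', div_div_eq_mul_div]; ring
    have e3 : A * ‖fderiv ℝ (v t) x‖ = (c / P t ^ q) * (A * (4 * S * ‖x - yc‖)) := by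
      rw [hNv, habs]; ring
    rw [e1, e2, e3, ← mul_sub]
    exact mul_le_mul_of_nonneg_left key (div_pos hcpos hPq).le
  have H8 : ContinuousOn (uncurry g) (Icc t_b t_T ×ˢ univ) := by
    have h1 : ContinuousOn (uncurry f) (Icc t_b t_T ×ˢ univ) :=
      (continuousOn_uncurry_of_lemma21 haA hf2 hfD heq).mono (prod_mono hIcc0 Subset.rfl)
    exact continuousOn_const.sub h1
  have H9 : ∀ t ∈ Ioc t_b t_T, ContDiff ℝ 2 (g t) := fun t ht =>
    contDiff_const.sub (hf2 t (hIoc0 ht))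
  have H10 : ∀ x, ContinuousOn (fun τ => fderiv ℝ (g τ) x) (Ioc t_b t_T) := by
    intro x
    have h1 : (fun τ => fderiv ℝ (g τ) x) = fun τ => -fderiv ℝ (f τ) x :=
      funext fun τ => fderiv_const_sub M₁
    rw [h1]
    exact (continuousOn_slab_slice hcD x hIoc0).neg
  have hΔg : ∀ τ < 0, ∀ x, (Δ (g τ)) x = -(Δ (f τ)) x := by
    intro τ hτ x
    have h1 : g τ = (fun _ => M₁) - f τ := by funext z; simp [hg]
    rw [h1, ContDiffAt.laplacian_sub contDiffAt_const (hf2 τ hτ).contDiffAt, laplacian_const]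
    simp
  have H11 : ∀ x, ContinuousOn (fun τ => (Δ (g τ)) x) (Ioc t_b t_T) := by
    intro x
    refine ((continuousOn_slab_slice hcΔ x hIoc0).neg).congr fun τ hτ => ?_
    exact hΔg τ (hIoc0 hτ) x
  have H12 : ∀ τ ∈ Ioc t_b t_T, ∀ x, ‖a τ x‖ ≤ A := fun τ hτ x => haA τ (hIoc0 hτ) x
  have hrhs : ∀ x, ∀ τ < 0, (Δ (g τ)) x - fderiv ℝ (g τ) x (a τ x) =
      -((Δ (f τ)) x - fderiv ℝ (f τ) x (a τ x)) := by
    intro x τ hτ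
    rw [hΔg τ hτ x, show fderiv ℝ (g τ) x = -fderiv ℝ (f τ) x from fderiv_const_sub M₁]
    simp only [neg_apply]
    ring
  have H13 : ∀ x, ∀ s t : ℝ, t_b < s → s ≤ t → t ≤ t_T →
      IntervalIntegrable (fun τ => (Δ (g τ)) x - fderiv ℝ (g τ) x (a τ x)) volume s t := by
    intro x s t hs hst ht
    have ht0 : t < 0 := lt_of_le_of_lt ht htT
    have h1 := (intervalIntegrable_lemma21_rhs ha_m haA hfD hcD hcΔ x hst ht0).neg
    refine h1.congr fun τ hτ => ?_
    rw [uIoc_of_le hst] at hτ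
    simp only [Pi.neg_apply]
    exact (hrhs x τ (lt_of_le_of_lt hτ.2 ht0)).symm
  have H14 : ∀ x, ∀ s t : ℝ, t_b < s → s ≤ t → t ≤ t_T →
      g t x - g s x = ∫ τ in s..t, ((Δ (g τ)) x - fderiv ℝ (g τ) x (a τ x)) := by
    intro x s t hs hst ht
    have ht0 : t < 0 := lt_of_le_of_lt ht htT
    have h1 := heq x s t hst ht0
    have h2 : ∫ τ in s..t, ((Δ (g τ)) x - fderiv ℝ (g τ) x (a τ x)) =
        ∫ τ in s..t, -((Δ (f τ)) x - fderiv ℝ (f τ) x (a τ x)) := by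
      refine intervalIntegral.integral_congr fun τ hτ => ?_
      rw [uIcc_of_le hst] at hτ
      exact hrhs x τ (lt_of_le_of_lt hτ.2 ht0)
    rw [h2, intervalIntegral.integral_neg, ← h1]
    simp only [hg]
    ring
  have H15 : ∀ x, ‖x - yc‖ ^ 2 ≤ P t_b → v t_b x ≤ g t_b x := by
    intro x hx
    rw [hPtb] at hx
    have hxL : ‖x - yc‖ ≤ ε * L := by
      refine le_of_sq_le_sq ?_ (by positivity)
      rw [mul_pow]; exact hx
    refine le_trans ?_ (hbottom x hxL)
    show (P t_b - ‖x - yc‖ ^ 2) ^ 2 / (P t_b ^ q / c) ≤ h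
    rw [hPtb]
    have h1 : (p₀ - ‖x - yc‖ ^ 2) ^ 2 ≤ p₀ ^ 2 := by
      have : 0 ≤ p₀ - ‖x - yc‖ ^ 2 := by linarith
      nlinarith [norm_nonneg (x - yc), sq_nonneg ‖x - yc‖]
    have h2 : (p₀ - ‖x - yc‖ ^ 2) ^ 2 / (p₀ ^ q / c) ≤ p₀ ^ 2 / (p₀ ^ q / c) :=
      div_le_div_of_nonneg_right h1 (by positivity)
    refine h2.trans (le_of_eq ?_)
    simp only [hc]
    field_simp
  have H16 : ∀ t ∈ Icc t_b t_T, ∀ x, ‖x - yc‖ ^ 2 = P t → v t x ≤ g t x := by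
    intro t ht x hx
    have h0 : v t x = 0 := by simp only [hv, hx, sub_self]; simp
    rw [h0]
    exact hg0 t (hIcc0 ht) x
  have hcomp :=
    paraboloid_comparison htb.le hPc H1 H2 H3 H4 H5 H6 H7 H8 H9 H10 H11 H12 H13 H14 H15 H16
  -- evaluation at the top time
  intro x hx
  have htTI : t_T ∈ Icc t_b t_T := ⟨htb.le, le_rfl⟩
  have hr4 : ‖x - yc‖ ^ 2 ≤ L ^ 2 / 4 := by nlinarith [norm_nonneg (x - yc)]
  have hxP : ‖x - yc‖ ^ 2 ≤ P t_T := by rw [hPtT]; nlinarith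
  have hvg := hcomp t_T htTI x hxP
  refine le_trans ?_ hvg
  show h / 2 * (ε ^ 2) ^ q / ε ^ 4 ≤ (P t_T - ‖x - yc‖ ^ 2) ^ 2 / (P t_T ^ q / c)
  rw [hPtT]
  set r : ℝ := ‖x - yc‖ ^ 2 with hr
  have hK : (L ^ 2 - r) ^ 2 / ((L ^ 2) ^ q / c) =
      (h * (ε ^ 2) ^ q / ε ^ 4) * ((L ^ 2 - r) ^ 2 / L ^ 4) := by
    simp only [hc, hp₀, mul_pow]
    field_simp
  rw [hK]
  have hfrac : 1 / 2 ≤ (L ^ 2 - r) ^ 2 / L ^ 4 := by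
    rw [div_le_div_iff₀ (by norm_num) (by positivity)]
    have h1 : 3 * L ^ 2 / 4 ≤ L ^ 2 - r := by linarith
    have h2 : (3 * L ^ 2 / 4) * (3 * L ^ 2 / 4) ≤ (L ^ 2 - r) * (L ^ 2 - r) :=
      mul_self_le_mul_self (by positivity) h1
    nlinarith [h2, sq_nonneg L]
  have hKpos : 0 ≤ h * (ε ^ 2) ^ q / ε ^ 4 := by positivity
  calc h / 2 * (ε ^ 2) ^ q / ε ^ 4 = (h * (ε ^ 2) ^ q / ε ^ 4) * (1 / 2) := by ring
    _ ≤ (h * (ε ^ 2) ^ q / ε ^ 4) * ((L ^ 2 - r) ^ 2 / L ^ 4) :=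
        mul_le_mul_of_nonneg_left hfrac hKpos

end Spread

end Literature.Analysis.FluidPDE

end
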